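import Summits.ValiantsHypothesis.ValiantsHypothesis.Theorems.FifoMatchingNNMonotoneHardReduction

/-!
# Crux `NNMonotoneHard` (stmt-ValiantsHypothesis-11617) — skeleton of line `thick-queue`

Composition: `NNMonotoneHard` follows from the landed reduction
`nnMonotoneHard_of_spread_measures` (Theorems/FifoMatchingNNMonotoneHardReduction.lean, p565662)
applied to ONE stub, the spread-measure lemma (★).  The intended proof of (★) (thick-queue uniform
measure, adaptive test lemma, many-boundaries lemma) is written out with sizes in
`Cruxes/NNMonotoneHard/PROOF-PLAN.md`; its pieces (A)–(F) become helper files landed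
`--supports stmt-ValiantsHypothesis-11617`, after which `stub_spreadMeasures` is their assembly (F).
-/

noncomputable section

set_option linter.dupNamespace false

namespace Summit.ValiantsHypothesis.ValiantsHypothesis.Cruxes.NNMonotoneHard.ThickQueue

open Literature.Computability.AlgebraicComplexity Finset
open scoped NNReal

/-- STUB (★): for every exponent `c` there are `n ≥ 3` and a probability weighting of the nest-free
perfect matchings of `[2n]` under which every balanced vertex split `S` (`2n < 3|S| ≤ 4n`) is
respected with mass `< 1 / (4 (n^c + c) (n+1)²)`.  Intended witness: the FIFO matchings of the
words `U^L v D^L`, `v` uniform of length `2n − 2L` conditioned on being Dyck, `n = k⁸`, `L = k⁶`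
(PROOF-PLAN.md §1–2). [folklore] -/
theorem stub_spreadMeasures :
    ∀ c : ℕ, ∃ n : ℕ, 3 ≤ n ∧ ∃ μ : (Fin (2 * n) → Fin (2 * n)) → ℝ≥0,
      (∑ M ∈ nestFreeMatchings (2 * n), μ M = 1) ∧
      ∀ S : Finset (Fin (2 * n)), 2 * n < 3 * S.card → 3 * S.card ≤ 4 * n →
        ((4 * (n ^ c + c) * (n + 1) ^ 2 : ℕ) : ℝ≥0) *
          (∑ M ∈ (nestFreeMatchings (2 * n)).filter (fun M => ∀ i, i ∈ S ↔ M i ∈ S), μ M) < 1 := by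
  sorry

/-- The composition: the crux `NNMonotoneHard` from the stub, by the landed reduction. [folklore] -/
theorem NNMonotoneHard_of :
    Summit.ValiantsHypothesis.ValiantsHypothesis.Theses.FifoMatching.NNMonotoneHard :=
  Summit.ValiantsHypothesis.ValiantsHypothesis.Theorems.FifoMatching.NNMonotoneHard.nnMonotoneHard_of_spread_measures
    stub_spreadMeasures

end Summit.ValiantsHypothesis.ValiantsHypothesis.Cruxes.NNMonotoneHard.ThickQueue
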